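import Summits.CriticalPhenomena.PercolationContinuityZ3.Theorems.PercNearOneGluingNoHeavyPcintBSMXKernel
import HarnessLib

/-!
# PCINT lane, PHASE 6 (block renewal with reach-two pieces): chunked fixed-point rows

Cell `prim-pcint`, seat `prim-pcint-1` (gen 15); memo `run/shared/lean/prim/pcint/T-FIBRE-ROUTE.md` §PHASE 6.

For long horizons `N` (two time axes, where the Green tail decays only like `N^{-1/2}`) the windowed rows of
…PcintBSMXCompute cannot be recomputed inside every kernel check.  Here the row recursion is restarted from
CHECKPOINT rows: `BSMX.hrowFrom start j` (`j` steps of the five-term stencil from an arbitrary row `start`);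
**`BSMX.rowDom_from`**: if `start` dominates `H n · D` on the window then `hrowFrom start j` dominates `H (n+j) · D`
(the same monotonicity argument as `BSMX.hrowW_getD`), and domination passes to any entrywise larger row
(`BSMX.rowDom_of_rowLE`, the Boolean test `BSMX.rowLE`).  A chain of checkpoint literals `starts` with
`starts[0] = row 0` and `hrowFrom starts[c] (2L) ≤ starts[c+1]` entrywise therefore dominates the rows `2cL`
(`BSMX.rowDom_chain`), the chunk Green sums `BSMX.GqN (termsFrom …)` dominate the true partial sums
(`BSMX.sum_Ico_le_GqNfrom`), and **`BSMX.G0H_le_of_chunks`** / **`BSMX.G1H_le_of_chunks`** assemble the real-form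
Green-table hypotheses of `BSMX.criticalProb_le_of_checks5` from per-chunk table checks and one light summation check.
The coefficient hypotheses are taken in real form (`u k i · DU ≤ U_i`), so that any certified source of the oriented
meeting probabilities can be used.
-/

noncomputable section

namespace Summit.CriticalPhenomena.PercolationContinuityZ3.Theorems.Pcint.BSMX

open Finset OSM BSM Literature.Probability.Percolation Literature.Probability.LatticeModels

variable {t k : ℕ}

/-! ### One step from an arbitrary row -/

/-- One step of the windowed five-term recursion from an arbitrary row. -/
def hstep (A0 A1 A2 DA D : ℕ) (row : List ℕ) : List ℕ :=
  let P := padRow D row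
  (hpass A0 A1 A2 (P.drop 4) (P.getD 0 0) (P.getD 1 0) (P.getD 2 0) (P.getD 3 0)).map (cdiv DA)

/-- `j` steps from a start row. -/
def hrowFrom (A0 A1 A2 DA D : ℕ) (start : List ℕ) : ℕ → List ℕ
  | 0 => start
  | j + 1 => hstep A0 A1 A2 DA D (hrowFrom A0 A1 A2 DA D start j)

/-- The original rows are the rows from row `0`. -/
theorem hrowW_eq_hrowFrom (A0 A1 A2 DA D W : ℕ) : ∀ n,
    hrowW A0 A1 A2 DA D W n = hrowFrom A0 A1 A2 DA D (hrowW A0 A1 A2 DA D W 0) n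
  | 0 => rfl
  | n + 1 => by rw [hrowFrom, ← hrowW_eq_hrowFrom A0 A1 A2 DA D W n]; rfl

/-- The step preserves the length. -/
theorem length_hstep (A0 A1 A2 DA D : ℕ) {row : List ℕ} {W : ℕ} (h : row.length = 2 * W + 1) :
    (hstep A0 A1 A2 DA D row).length = 2 * W + 1 := by
  unfold hstep
  simp only [List.length_map, length_hpass, List.length_drop, padRow, List.length_cons, List.length_append,
    List.length_nil, h]
  omega

/-- Entries of one step, for `j ≤ 2W`. -/
theorem hstep_getD (A0 A1 A2 DA D : ℕ) {row : List ℕ} {W : ℕ} (h : row.length = 2 * W + 1) (j : ℕ) (hj : j ≤ 2 * W) :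
    (hstep A0 A1 A2 DA D row).getD j 0 =
      cdiv DA (A2 * ((padRow D row).getD j 0 + (padRow D row).getD (j + 4) 0) +
        A1 * ((padRow D row).getD (j + 1) 0 + (padRow D row).getD (j + 3) 0) + A0 * (padRow D row).getD (j + 2) 0) := by
  set P := padRow D row with hP
  have hdrop : (P.drop 4).length = 2 * W + 1 := by
    rw [hP, List.length_drop, padRow, List.length_cons, List.length_cons, List.length_append, h]; simp
  unfold hstep
  rw [getD_map_cdiv]
  rw [hpass_getD A0 A1 A2 _ _ _ _ _ j (by rw [hdrop]; omega), padRow_eq D _ (by rw [h]; omega)]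

/-! ### Domination of rows -/

/-- **Row domination**: `row` has the window length and dominates `H n · D` on the window. -/
def RowDom (A1 A2 DA D W n : ℕ) (row : List ℕ) : Prop :=
  row.length = 2 * W + 1 ∧ ∀ j ≤ 2 * W, H ((A1 : ℝ) / DA) ((A2 : ℝ) / DA) n ((j : ℤ) - W) * D ≤ (row.getD j 0 : ℝ)

/-- Row `0` dominates. -/
theorem rowDom_zero {A0 A1 A2 DA : ℕ} (hDA : A0 + 2 * A1 + 2 * A2 = DA) (hDA0 : 0 < DA) (D W : ℕ) :
    RowDom A1 A2 DA D W 0 (hrowW A0 A1 A2 DA D W 0) :=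
  ⟨length_hrowW A0 A1 A2 DA D W 0, fun j hj => hrowW_getD hDA hDA0 D W 0 j hj⟩

/-- **The step preserves domination.** -/
theorem rowDom_step {A0 A1 A2 DA : ℕ} (hDA : A0 + 2 * A1 + 2 * A2 = DA) (hDA0 : 0 < DA) {D W n : ℕ} {row : List ℕ}
    (hr : RowDom A1 A2 DA D W n row) : RowDom A1 A2 DA D W (n + 1) (hstep A0 A1 A2 DA D row) := by
  obtain ⟨hlen, hdomr⟩ := hr
  refine ⟨length_hstep A0 A1 A2 DA D hlen, fun j hj => ?_⟩
  have hDAR : (0 : ℝ) < DA := by exact_mod_cast hDA0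
  set a₁ : ℝ := (A1 : ℝ) / DA with ha₁
  set a₂ : ℝ := (A2 : ℝ) / DA with ha₂
  have h1 : 0 ≤ a₁ := by positivity
  have h2 : 0 ≤ a₂ := by positivity
  have h12 : 2 * a₁ + 2 * a₂ ≤ 1 := by
    rw [ha₁, ha₂]
    have : (2 * A1 + 2 * A2 : ℝ) ≤ DA := by exact_mod_cast (by omega : 2 * A1 + 2 * A2 ≤ DA)
    rw [show 2 * ((A1 : ℝ) / DA) + 2 * ((A2 : ℝ) / DA) = (2 * A1 + 2 * A2) / DA by ring, div_le_one hDAR]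
    exact this
  have ha0 : 1 - 2 * a₁ - 2 * a₂ = (A0 : ℝ) / DA := by
    rw [ha₁, ha₂, eq_div_iff hDAR.ne']
    have : ((A0 + 2 * A1 + 2 * A2 : ℕ) : ℝ) = DA := by exact_mod_cast hDA
    push_cast at this
    field_simp
    linarith
  set P := padRow D row with hP
  have hdom : ∀ i, i < 2 * W + 5 → H a₁ a₂ n ((i : ℤ) - 2 - W) * D ≤ (P.getD i 0 : ℝ) := by
    intro i hi
    rw [hP, padRow_getD D hlen i (by omega)]
    have hle1 : H a₁ a₂ n ((i : ℤ) - 2 - W) * D ≤ (D : ℝ) := by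
      have := H_le_one h1 h2 h12 n ((i : ℤ) - 2 - W)
      have hD : (0 : ℝ) ≤ D := Nat.cast_nonneg D
      nlinarith
    split_ifs with hi2 hi3
    · exact hle1
    · have := hdomr (i - 2) (by omega)
      rwa [show (((i - 2 : ℕ) : ℤ) - W) = (i : ℤ) - 2 - W by push_cast [Nat.cast_sub (by omega : 2 ≤ i)]; ring] at this
    · exact hle1
  rw [hstep_getD A0 A1 A2 DA D hlen j hj]
  refine le_trans ?_ (le_cdiv hDA0 _)
  rw [H_succ_five, le_div_iff₀ hDAR]
  have e0 := hdom j (by omega)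
  have e1 := hdom (j + 1) (by omega)
  have e2 := hdom (j + 2) (by omega)
  have e3 := hdom (j + 3) (by omega)
  have e4 := hdom (j + 4) (by omega)
  have f0 : H a₁ a₂ n ((j : ℤ) - W - 2) * D ≤ (P.getD j 0 : ℝ) := by
    convert e0 using 3; ring
  have f1 : H a₁ a₂ n ((j : ℤ) - W - 1) * D ≤ (P.getD (j + 1) 0 : ℝ) := by
    convert e1 using 3; push_cast; ring
  have f2 : H a₁ a₂ n ((j : ℤ) - W) * D ≤ (P.getD (j + 2) 0 : ℝ) := by
    convert e2 using 3; push_cast; ring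
  have f3 : H a₁ a₂ n ((j : ℤ) - W + 1) * D ≤ (P.getD (j + 3) 0 : ℝ) := by
    convert e3 using 3; push_cast; ring
  have f4 : H a₁ a₂ n ((j : ℤ) - W + 2) * D ≤ (P.getD (j + 4) 0 : ℝ) := by
    convert e4 using 3; push_cast; ring
  have hA0 : (0 : ℝ) ≤ A0 := Nat.cast_nonneg A0
  have hA1 : (0 : ℝ) ≤ A1 := Nat.cast_nonneg A1
  have hA2 : (0 : ℝ) ≤ A2 := Nat.cast_nonneg A2
  rw [ha0]
  push_cast
  have key : ((A2 : ℝ) / DA * H a₁ a₂ n ((j : ℤ) - W + 2) + (A1 : ℝ) / DA * H a₁ a₂ n ((j : ℤ) - W + 1) +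
      (A0 : ℝ) / DA * H a₁ a₂ n ((j : ℤ) - W) + (A1 : ℝ) / DA * H a₁ a₂ n ((j : ℤ) - W - 1) +
        (A2 : ℝ) / DA * H a₁ a₂ n ((j : ℤ) - W - 2)) * D * DA =
      A2 * (H a₁ a₂ n ((j : ℤ) - W - 2) * D + H a₁ a₂ n ((j : ℤ) - W + 2) * D) +
        A1 * (H a₁ a₂ n ((j : ℤ) - W - 1) * D + H a₁ a₂ n ((j : ℤ) - W + 1) * D) +
          A0 * (H a₁ a₂ n ((j : ℤ) - W) * D) := by
    field_simp
    ring
  rw [ha₁, ha₂] at key ⊢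
  rw [key]
  have m2 := mul_le_mul_of_nonneg_left (add_le_add f0 f4) hA2
  have m1 := mul_le_mul_of_nonneg_left (add_le_add f1 f3) hA1
  have m0 := mul_le_mul_of_nonneg_left f2 hA0
  linarith

/-- **Rows from a dominating checkpoint dominate.** -/
theorem rowDom_from {A0 A1 A2 DA : ℕ} (hDA : A0 + 2 * A1 + 2 * A2 = DA) (hDA0 : 0 < DA) {D W n : ℕ} {start : List ℕ}
    (hs : RowDom A1 A2 DA D W n start) : ∀ j, RowDom A1 A2 DA D W (n + j) (hrowFrom A0 A1 A2 DA D start j)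
  | 0 => hs
  | j + 1 => by
    rw [hrowFrom, ← add_assoc]
    exact rowDom_step hDA hDA0 (rowDom_from hDA hDA0 hs j)

/-- **Entrywise comparison of rows** (a Boolean test: equal lengths and `r[j] ≤ s[j]` for all `j`). -/
def rowLE (r s : List ℕ) : Bool :=
  (r.length == s.length) && (List.range s.length).all fun j => decide (r.getD j 0 ≤ s.getD j 0)

/-- The Boolean test implies the entrywise comparison. -/
theorem rowLE_spec {r s : List ℕ} (h : rowLE r s = true) :
    r.length = s.length ∧ ∀ j < s.length, r.getD j 0 ≤ s.getD j 0 := by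
  unfold rowLE at h
  rw [Bool.and_eq_true, beq_iff_eq, List.all_eq_true] at h
  exact ⟨h.1, fun j hj => of_decide_eq_true (h.2 j (List.mem_range.2 hj))⟩

/-- Domination passes to entrywise larger rows. -/
theorem rowDom_of_rowLE {A1 A2 DA D W n : ℕ} {r s : List ℕ} (hr : RowDom A1 A2 DA D W n r) (hle : rowLE r s = true) :
    RowDom A1 A2 DA D W n s := by
  obtain ⟨hlen, hdom⟩ := hr
  obtain ⟨hlen', hle⟩ := rowLE_spec hle
  refine ⟨by rw [← hlen', hlen], fun j hj => (hdom j hj).trans ?_⟩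
  exact_mod_cast hle j (by rw [← hlen', hlen]; omega)

/-- **A chain of checkpoints**: `starts[0] = row 0` and `hrowFrom starts[c] L' ≤ starts[c+1]` entrywise for `c+1 < C`
⇒ `starts[c]` dominates row `c · L'` for every `c < C`. -/
theorem rowDom_chain {A0 A1 A2 DA : ℕ} (hDA : A0 + 2 * A1 + 2 * A2 = DA) (hDA0 : 0 < DA) (D W L' : ℕ)
    (starts : List (List ℕ)) (C : ℕ) (h0 : starts.getD 0 [] = hrowW A0 A1 A2 DA D W 0)
    (hnext : ∀ c ∈ List.range (C - 1), rowLE (hrowFrom A0 A1 A2 DA D (starts.getD c []) L') (starts.getD (c + 1) []) = true) :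
    ∀ c < C, RowDom A1 A2 DA D W (c * L') (starts.getD c []) := by
  intro c
  induction c with
  | zero => intro _; rw [h0, Nat.zero_mul]; exact rowDom_zero hDA hDA0 D W
  | succ c ih =>
    intro hc
    have hprev := ih (by omega)
    have hle := hnext c (List.mem_range.2 (by omega))
    have := rowDom_from hDA hDA0 hprev L'
    rw [show (c + 1) * L' = c * L' + L' by ring]
    exact rowDom_of_rowLE this hle

/-! ### Chunk Green sums -/

/-- All rows `0..M` from a start row, built with sharing. -/
def hrowsFrom (A0 A1 A2 DA D : ℕ) (start : List ℕ) : ℕ → List (List ℕ)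
  | 0 => [start]
  | M + 1 =>
    let rs := hrowsFrom A0 A1 A2 DA D start M
    rs ++ [hstep A0 A1 A2 DA D (rs.getD M [])]

/-- The list of rows is correct. -/
theorem hrowsFrom_getD (A0 A1 A2 DA D : ℕ) (start : List ℕ) :
    ∀ (M n : ℕ), n ≤ M → (hrowsFrom A0 A1 A2 DA D start M).getD n [] = hrowFrom A0 A1 A2 DA D start n ∧
      (hrowsFrom A0 A1 A2 DA D start M).length = M + 1
  | 0, n, hn => by
    have : n = 0 := by omega
    subst this; exact ⟨rfl, rfl⟩
  | M + 1, n, hn => by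
    have hlen : (hrowsFrom A0 A1 A2 DA D start M).length = M + 1 := (hrowsFrom_getD A0 A1 A2 DA D start M 0 (Nat.zero_le _)).2
    refine ⟨?_, by simp [hrowsFrom, hlen]⟩
    show (hrowsFrom A0 A1 A2 DA D start M ++ [_]).getD n [] = hrowFrom A0 A1 A2 DA D start n
    rcases Nat.lt_or_ge n (M + 1) with h | h
    · rw [List.getD_append _ _ _ _ (by rw [hlen]; exact h)]
      exact (hrowsFrom_getD A0 A1 A2 DA D start M n (by omega)).1
    · have hn' : n = M + 1 := by omega
      subst hn'
      rw [List.getD_append_right _ _ _ _ (by rw [hlen])]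
      rw [hlen, Nat.sub_self, List.getD_cons_zero, (hrowsFrom_getD A0 A1 A2 DA D start M M le_rfl).1]
      rfl

/-- The term data of a chunk of `L` terms started at term `i₀` (rows from the checkpoint for row `2 i₀`). -/
def termsFrom (A0 A1 A2 DA D : ℕ) (start : List ℕ) (W Dd L i₀ : ℕ) (Wc : List ℕ) : List (ℕ × List ℕ) :=
  let rs := hrowsFrom A0 A1 A2 DA D start (2 * L)
  List.ofFn fun j : Fin L => (Wc.getD (i₀ + j) 0, hvals (rs.getD (2 * j) []) W Dd)

/-- **A chunk Green sum dominates** the true partial sum over `[i₀, i₀ + L)` (scaled by `DU · D^t`). -/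
theorem sum_Ico_le_GqNfrom {A0 A1 A2 DA : ℕ} (hDA : A0 + 2 * A1 + 2 * A2 = DA) (hDA0 : 0 < DA) {D DU W Dd L i₀ : ℕ}
    (hDd : Dd ≤ W) {start : List ℕ} (hs : RowDom A1 A2 DA D W (2 * i₀) start) {Wc : List ℕ} {c : ℕ → ℝ}
    (hcW : ∀ i < i₀ + L, c i * DU ≤ (Wc.getD i 0 : ℝ)) {δ : Fin t → ℤ} (hδ : δ ∈ Box t Dd) :
    (∑ i ∈ Ico i₀ (i₀ + L), c i * ∏ l, H ((A1 : ℝ) / DA) ((A2 : ℝ) / DA) (2 * i) (δ l)) * ((DU : ℝ) * (D : ℝ) ^ t) ≤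
      ((GqN (termsFrom A0 A1 A2 DA D start W Dd L i₀ Wc) Dd δ : ℕ) : ℝ) := by
  rw [mem_Box] at hδ
  have hDAR : (0 : ℝ) < DA := by exact_mod_cast hDA0
  set a₁ : ℝ := (A1 : ℝ) / DA
  set a₂ : ℝ := (A2 : ℝ) / DA
  have h1 : 0 ≤ a₁ := by positivity
  have h2 : 0 ≤ a₂ := by positivity
  have h12 : 2 * a₁ + 2 * a₂ ≤ 1 := by
    have : (2 * A1 + 2 * A2 : ℝ) ≤ DA := by exact_mod_cast (by omega : 2 * A1 + 2 * A2 ≤ DA)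
    rw [show 2 * a₁ + 2 * a₂ = (2 * A1 + 2 * A2) / DA by ring, div_le_one hDAR]
    exact this
  unfold GqN termsFrom
  rw [List.map_ofFn, List.sum_ofFn, Finset.sum_Ico_eq_sum_range, Nat.add_sub_cancel_left, ← Fin.sum_univ_eq_sum_range,
    sum_mul]
  push_cast
  refine sum_le_sum fun j _ => ?_
  have hjL : (j : ℕ) < L := j.2
  simp only [Function.comp_apply]
  rw [(hrowsFrom_getD A0 A1 A2 DA D start (2 * L) (2 * j) (by omega)).1]
  -- the row `2j` from the checkpoint dominates `H (2 i₀ + 2 j) = H (2 (i₀ + j))`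
  have hrow := rowDom_from hDA hDA0 hs (2 * j)
  rw [show 2 * i₀ + 2 * (j : ℕ) = 2 * (i₀ + j) by ring] at hrow
  have hT : ∀ l, H a₁ a₂ (2 * (i₀ + j)) (δ l) * D ≤
      (((hvals (hrowFrom A0 A1 A2 DA D start (2 * j)) W Dd).getD (δ l + Dd).toNat 0 : ℕ) : ℝ) := by
    intro l
    unfold hvals
    rw [getD_map_range _ _ (by have := hδ l; omega)]
    have := hrow.2 ((δ l + Dd).toNat + W - Dd) (by have := hδ l; omega)
    rwa [show ((((δ l + Dd).toNat + W - Dd : ℕ) : ℤ) - W) = δ l by have := hδ l; omega] at this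
  have hH0 : ∀ l, 0 ≤ H a₁ a₂ (2 * (i₀ + j)) (δ l) := fun l => H_nonneg h1 h2 h12 _ _
  calc c (i₀ + j) * (∏ l, H a₁ a₂ (2 * (i₀ + (j : ℕ))) (δ l)) * ((DU : ℝ) * (D : ℝ) ^ t)
      = (c (i₀ + j) * DU) * ∏ l, (H a₁ a₂ (2 * (i₀ + j)) (δ l) * D) := by
        rw [prod_mul_distrib, prod_const, Finset.card_univ, Fintype.card_fin]; ring
    _ ≤ (Wc.getD (i₀ + j) 0 : ℝ) *
          ∏ l, (((hvals (hrowFrom A0 A1 A2 DA D start (2 * j)) W Dd).getD (δ l + Dd).toNat 0 : ℕ) : ℝ) := by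
        refine mul_le_mul (hcW (i₀ + j) (by omega)) (prod_le_prod (fun l _ => mul_nonneg (hH0 l) (by positivity))
          fun l _ => hT l) (prod_nonneg fun l _ => mul_nonneg (hH0 l) (by positivity)) (by positivity)
    _ = _ := by push_cast; rfl

/-! ### Assembling the Green-table hypotheses from chunks -/

/-- Splitting `Σ_{i < C L}` into chunks. -/
theorem sum_range_mul_eq_sum_chunks (f : ℕ → ℝ) (L : ℕ) : ∀ C : ℕ,
    ∑ i ∈ range (C * L), f i = ∑ c ∈ range C, ∑ i ∈ Ico (c * L) (c * L + L), f i
  | 0 => by simp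
  | C + 1 => by
    rw [sum_range_succ, ← sum_range_mul_eq_sum_chunks f L C, show (C + 1) * L = C * L + L by ring,
      ← Finset.sum_range_add_sum_Ico _ (Nat.le_add_right _ _)]

/-- **The Green tables from chunked checks** (generic coefficients `c_i` with `c_i · DU ≤ Wc_i`):
the per-chunk table checks and the summation check give `Σ_{i<CL} c_i Π H(2i) · DG ≤ Gn δ`. -/
theorem green_le_of_chunks {A0 A1 A2 DA : ℕ} (hDA : A0 + 2 * A1 + 2 * A2 = DA) (hDA0 : 0 < DA) {D DU W L C : ℕ}
    (hD : 0 < D) (hDU : 0 < DU) (hW : 12 ≤ W) (starts : List (List ℕ))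
    (h0 : starts.getD 0 [] = hrowW A0 A1 A2 DA D W 0)
    (hnext : ∀ c ∈ List.range (C - 1),
      rowLE (hrowFrom A0 A1 A2 DA D (starts.getD c []) (2 * L)) (starts.getD (c + 1) []) = true)
    {Wc : List ℕ} {c : ℕ → ℝ} (hcW : ∀ i < C * L, c i * DU ≤ (Wc.getD i 0 : ℝ))
    (Ptab : ℕ → (Fin t → ℤ) → ℕ) {DG : ℕ} {Gn : (Fin t → ℤ) → ℕ} {δ : Fin t → ℤ} (hδ : δ ∈ Box t 12)
    (hparts : ∀ cc ∈ List.range C, GqN (termsFrom A0 A1 A2 DA D (starts.getD cc []) W 12 L (cc * L) Wc) 12 δ ≤ Ptab cc δ)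
    (hsum : ((List.range C).map fun cc => Ptab cc δ).sum * DG ≤ Gn δ * (DU * D ^ t)) :
    (∑ i ∈ range (C * L), c i * ∏ l, H ((A1 : ℝ) / DA) ((A2 : ℝ) / DA) (2 * i) (δ l)) * DG ≤ Gn δ := by
  have hM : (0 : ℝ) < (DU : ℝ) * (D : ℝ) ^ t := by positivity
  have hdom := rowDom_chain hDA hDA0 D W (2 * L) starts C h0 hnext
  -- each chunk
  have hchunk : ∀ cc < C, (∑ i ∈ Ico (cc * L) (cc * L + L), c i * ∏ l, H ((A1 : ℝ) / DA) ((A2 : ℝ) / DA) (2 * i) (δ l)) *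
      ((DU : ℝ) * (D : ℝ) ^ t) ≤ (Ptab cc δ : ℝ) := by
    intro cc hcc
    have hs := hdom cc hcc
    rw [show cc * (2 * L) = 2 * (cc * L) by ring] at hs
    refine (sum_Ico_le_GqNfrom hDA hDA0 hW hs (fun i hi => hcW i ?_) hδ).trans ?_
    · have : cc * L + L ≤ C * L := by nlinarith
      omega
    · exact_mod_cast hparts cc (List.mem_range.2 hcc)
  have htot : (∑ i ∈ range (C * L), c i * ∏ l, H ((A1 : ℝ) / DA) ((A2 : ℝ) / DA) (2 * i) (δ l)) *
      ((DU : ℝ) * (D : ℝ) ^ t) ≤ ∑ cc ∈ range C, (Ptab cc δ : ℝ) := by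
    rw [sum_range_mul_eq_sum_chunks, sum_mul]
    exact sum_le_sum fun cc hcc => hchunk cc (mem_range.1 hcc)
  have hsum' : (∑ cc ∈ range C, (Ptab cc δ : ℝ)) * DG ≤ (Gn δ : ℝ) * ((DU : ℝ) * (D : ℝ) ^ t) := by
    have := hsum
    have e : ((List.range C).map fun cc => Ptab cc δ).sum = ∑ cc ∈ range C, Ptab cc δ := by
      rw [← List.sum_toFinset _ List.nodup_range, List.toFinset_range]
    rw [e] at this
    exact_mod_cast this
  have hDG : (0 : ℝ) ≤ DG := Nat.cast_nonneg DG
  nlinarith [mul_le_mul_of_nonneg_right htot hDG]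

/-- **The diagonal Green table from chunked checks.** -/
theorem G0H_le_of_chunks {A0 A1 A2 DA : ℕ} (hDA : A0 + 2 * A1 + 2 * A2 = DA) (hDA0 : 0 < DA) {D DU W L C : ℕ}
    (hD : 0 < D) (hDU : 0 < DU) (hW : 12 ≤ W) (starts : List (List ℕ))
    (h0 : starts.getD 0 [] = hrowW A0 A1 A2 DA D W 0)
    (hnext : ∀ c ∈ List.range (C - 1),
      rowLE (hrowFrom A0 A1 A2 DA D (starts.getD c []) (2 * L)) (starts.getD (c + 1) []) = true)
    {U : List ℕ} (hU : ∀ i < C * L, u k i * DU ≤ (U.getD i 0 : ℝ))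
    (Ptab : ℕ → (Fin t → ℤ) → ℕ) {DG : ℕ} {G0n : (Fin t → ℤ) → ℕ} {δ : Fin t → ℤ} (hδ : δ ∈ Box t 12)
    (hparts : ∀ cc ∈ List.range C, GqN (termsFrom A0 A1 A2 DA D (starts.getD cc []) W 12 L (cc * L) U) 12 δ ≤ Ptab cc δ)
    (hsum : ((List.range C).map fun cc => Ptab cc δ).sum * DG ≤ G0n δ * (DU * D ^ t)) :
    G0H k ((A1 : ℝ) / DA) ((A2 : ℝ) / DA) (C * L) δ * DG ≤ G0n δ :=
  green_le_of_chunks hDA hDA0 hD hDU hW starts h0 hnext hU Ptab hδ hparts hsum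

/-- **The adjacent Green table from chunked checks.** -/
theorem G1H_le_of_chunks {A0 A1 A2 DA : ℕ} (hDA : A0 + 2 * A1 + 2 * A2 = DA) (hDA0 : 0 < DA)
    {D DU W L C : ℕ} (hD : 0 < D) (hDU : 0 < DU) (hW : 12 ≤ W) (starts : List (List ℕ))
    (h0 : starts.getD 0 [] = hrowW A0 A1 A2 DA D W 0)
    (hnext : ∀ c ∈ List.range (C - 1),
      rowLE (hrowFrom A0 A1 A2 DA D (starts.getD c []) (2 * L)) (starts.getD (c + 1) []) = true)
    {Cl : List ℕ} (hC : ∀ i < C * L, cadj k i * DU ≤ (Cl.getD i 0 : ℝ))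
    (Ptab : ℕ → (Fin t → ℤ) → ℕ) {DG : ℕ} {G1n : (Fin t → ℤ) → ℕ} {δ : Fin t → ℤ} (hδ : δ ∈ Box t 12)
    (hparts : ∀ cc ∈ List.range C, GqN (termsFrom A0 A1 A2 DA D (starts.getD cc []) W 12 L (cc * L) Cl) 12 δ ≤ Ptab cc δ)
    (hsum : ((List.range C).map fun cc => Ptab cc δ).sum * DG ≤ G1n δ * (DU * D ^ t)) :
    G1H k ((A1 : ℝ) / DA) ((A2 : ℝ) / DA) (C * L) δ * DG ≤ G1n δ :=
  green_le_of_chunks hDA hDA0 hD hDU hW starts h0 hnext hC Ptab hδ hparts hsum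

end Summit.CriticalPhenomena.PercolationContinuityZ3.Theorems.Pcint.BSMX

end
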